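/-
Copyright: statement-level skeleton of a published paper (lit-balaban cell, Phase-2 proof seat p32 gen 44). No claims beyond
what the kernel checks below.
-/
import Literature.MathematicalPhysics.QuantumFieldTheory.Balaban1983to89.B3OnePIChainPieceGraphs

/-!
# B3 — T. Bałaban, *(Higgs)₂,₃ quantum fields in a finite volume. III. Renormalization*, CMP **88** (1983) 411–445
[Balaban1983Higgs3] — p. 416 [PDF 6] (1.21): UNGLUING — «GLUE ∘ DECOMPOSE ≅ IDENTITY»: a connected two-leg graph of the model
whose separating lines are φ′-lines and whose pieces span lines IS, up to isomorphism, p37's `chain` of its own pieces; and the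
CHARACTERIZATION of the image of `chain` over letters (connected insertions proper between their ports): «connected two-point
graph = chain of proper insertions joined by single propagator lines» in both directions, up to isomorphism

statement-level skeleton of published theorems with citation tags; proofs where landed; nothing here is a claim about
the Yang–Mills mass gap

PDF held: `paper:balaban1983-higgs-2-3-quantum-fields-finite-volume` (journal page = PDF page + 410); p. 415 L28–31 and p. 416
L13–18 of the OCR text layer re-read this session (`lit read … --pages 5-6`).

CITATION HEADER (lean-in-tree rule).  lit-balaban TYPED SKELETON (HOME `run/shared/lean/pub/lit-balaban/`), PHASE 2, seat p32
gen 44 (unit `lit-balaban-p32`; TAKING line HOME/STATUS.md 2026-08-23T13:19:54Z, free-target protocol G.5-34(d); FILE 2b of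
the item «glue ∘ decompose ≅ identity» = p32 gen 43 HANDOFF (d)(γ), the element r15's gen-42/43 fold of the (1.21) cell carries
as NOT done: «no sub-object isomorphism»), row **B3.Eq1.19-1.22** of `HOME/lit-balaban-r15/ROWS-B3.md` (fold owner r15, referee
ref-4; head `proved` under the lead g12 HEAD WORD Q25, reading (P); an OPTIONAL located member of its (1.21) cell, zero head
weight).  CONSUMES BY NAME: p37's `B3OnePIChainGlue.TwoLegGraph` / `chain` (p363250), `B3GraphGlue.glue` via gen 43's block
calculus `B3OnePIChainBlocks.letter` / `blockEmb` / `legEmb` / `kind_blockEmb` / `blockEmb_injective` / `exists_blockEmb_eq` /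
`blockOf_blockEmb_of_le` / `other_legEmb` / `other_legEmb_legOut` / `other_legEmb_succ_legIn` / `other_legEmb_eq_none_iff` /
`legEmb_zero_legIn` / `legEmb_length_legOut` / `mem_nearLegs_chain_iff` / `level_chain_blockEmb` (p365352),
`B3OnePIChainGlueCount.numSep_chain` (p364147), p32's `B3OnePIChainDecomposition.level_le` / `level_eq_of_not_sep` /
`Sep.level_cases` / `IsNear.level_lt` (p361829), `B3GraphIso.GraphIso` / `TwoLegGraphIso` / `legOf` / `leg_ext` (p366156), and the
sibling `B3OnePIChainPieceGraphs` (ports, `Unglueable`, `piece`, `liftLeg`, `pieceIdx`, `isConnected_piece`, `numSep_piece`).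
Nothing re-declared.

THE PRINTED TEXT (verbatim).  p. 416: *"The function G^ε has a perturbative expansion of the following structure
G^ε = Σ_{n=0}^∞ C₀^ε[(−δm² + Σ^ε + ∂^{ε*}Σ₁^ε + Σ₁^{ε*}∂^ε + ∂^{ε*}Σ₂^ε∂^ε)C₀^ε]ⁿ, (1.21) where C₀^ε = (−Δ₀^ε + m²)^{−1} and
Σ^ε, Σ₁^ε, Σ₂^ε are given by amputated, one-particle-irreducible graphs of the expansion of G^ε."*  p. 415: *"Now a graph for us
is a collection of internal lines, external legs, and vertices connected in the usual sense. There is at least one internal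
line, and every internal line has a vertex at each endpoint."*  Print states the chain structure of (1.21) without proof (the
standard combinatorics of formal perturbation theory); gen 42 proved it at vertex level, p37 g106 built the glue, gen 43 showed
«decompose ∘ glue = id»; this file closes the circle: «glue ∘ decompose ≅ id» and the exact image of the chain construction.

KIND «(ours)» (G.5-54): OUR plumbing on p18's model — print provenance is claimed only for the sentences quoted above; each
declaration's cite tag locates the printed notion it serves.
WHAT IS TYPED / PROVED (definitions with bodies + theorems; no `Prop` fact, no `sorry`; standard axioms).  Local notations
`Lv T v` = `level T.G T.legIn.1 T.legOut.1 v`, `Ns T` = `numSep T.G T.legIn.1 T.legOut.1`.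
* `§3` THE GENERAL UNGLUING.  `legEmb_eq_legOf` (gen 43's leg embedding is the `legOf` of its block embedding); the datum
  **`Letters T hU`** (a head letter, `m` further letters, and isomorphisms `iso k : piece T hU k ≅ letter head tail k`); the
  vertex map `unglueVert` (a vertex of level `k` ↦ `blockEmb k (iso k (its index in V_k))`; `unglueVert_eq`, `blockOf_unglueVert`,
  **`unglueVert_injective`**, **`unglueVert_surjective`**), `unglueEquiv`, **`kind_unglueVert`**, **`legOf_unglueVert_eq`** (the
  induced leg map = `legEmb k ∘ (iso k).legMap ∘ liftLeg`), **`other_legOf_unglueVert`** (THE LINES ARE CARRIED: external legs ↦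
  external legs by `other_legEmb_eq_none_iff`, lines inside `V_k` ↦ embedded lines of the `k`-th letter by `other_legEmb`, the
  `k`-th separating line ↦ the `k`-th glue line by `other_legEmb_legOut` / `_succ_legIn` — gen 42's `Sep.level_cases` sorts the
  cases), and **`unglueIso D : TwoLegGraphIso T (chain D.head D.tail)`** (ports ↦ ports by `legEmb_zero_legIn` /
  `legEmb_length_legOut`).
* `§4` THE CANONICAL TRANSCRIPTION: `isoOfEq`, `headPiece` / `tailPieces` (`List.ofFn` of the pieces `1 … m`), `letter_pieces`
  (the `k`-th letter IS the `k`-th piece), `pieceLetters`, **`isoChainPieces T hU : TwoLegGraphIso T (chain (headPiece T hU)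
  (tailPieces T hU))`** — THE HEADLINE — `letter_pieces_connected_proper`, **`exists_iso_chain`** (∃ `m + 1` connected
  port-proper letters with `T ≅` their chain).
* `§5` LETTERS AND THE CHARACTERIZATION: **`IsLetter X`** (connected ∧ `numSep = 0` between the ports), `isLetter_of_isProper`
  (p37's proper / 1PI insertions are letters), `isLetter_iff_of_iso`, `isLetter_piece`; `forall_mem_of_forall_letter`,
  **`numSep_chain_of_letters`** (`= l.length`), **`level_chain_blockEmb_of_letters`** (`= k`), **`unglueable_chain`** (a chain of
  letters is unglueable: its separating lines are the glue lines — φ′-lines — and block `k` spans a line of letter `k`),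
  **`unglueable_of_iso`** / `unglueable_iff_of_iso`, **`unglueable_iff_nonempty_iso_chain`** (THE CHARACTERIZATION: `T` ≅ a chain
  of letters ⇔ `Unglueable T`), **`length_eq_numSep_of_iso`** (the number of letters is `numSep T + 1`).
HONEST SCOPE.  (i) Letters of the model are `TwoLegGraph`s: a chain met in print may also contain the bare mass-counterterm
vertex (1.7) as the separate letter `−δm²` of (1.21), which is not a graph (p. 415) — such two-point graphs violate hypothesis (b)
and are outside the image of `chain`; likewise (a) excludes vector separating lines (possible on p18's carrier through vertices
(1.13)–(1.15)); both are characterized, not treated.  (ii) The isomorphism keeps leg slots (`B3GraphIso`); no quotient by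
isomorphism, no symmetry factors, no enumeration of isomorphism classes — so BRICK 2's `sigmaSeries_eq_greenSeries_of_equiv`
(an `Equiv` between INDEX TYPES) is still not instantiated; uniqueness of the letters up to isomorphism (letter `k` ≅ piece `k`
for ANY transcription) is not stated here.  (iii) No amplitude (p37 g108's K1–K3 are the amplitude side); nothing analytic;
the Dyson resummation of (1.19) itself is not derived here.
-/

namespace Literature.MathematicalPhysics.QuantumFieldTheory.Balaban1983to89.B3OnePIChainUnglue

open Relation Finset B3Prop1 B3Cor23Concrete B3OnePIGraphs B3OnePIChainDecomposition B3OnePIChainPieces B3GraphGlueLegs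
  B3GraphGlue B3OnePIChainGlue B3OnePIChainGlueCount B3OnePIChainBlocks B3GraphIso B3OnePIChainPieceGraphs

variable {nbar : ℕ}

/-- `Lv T v`: the LEVEL of the vertex `v` of the two-leg insertion `T` between its ports (local notation for p32's
`B3OnePIChainDecomposition.level T.G T.legIn.1 T.legOut.1 v`). -/
local notation:max "Lv " T:max =>
  level (TwoLegGraph.G T) (Sigma.fst (TwoLegGraph.legIn T)) (Sigma.fst (TwoLegGraph.legOut T))

/-- `Ns T`: the NUMBER OF SEPARATING LINES `m` between the ports of `T` (local notation for
`B3OnePIChainDecomposition.numSep T.G T.legIn.1 T.legOut.1`). -/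
local notation:max "Ns " T:max =>
  numSep (TwoLegGraph.G T) (Sigma.fst (TwoLegGraph.legIn T)) (Sigma.fst (TwoLegGraph.legOut T))

/-! ## §3 Ungluing: the isomorphism onto a chain whose letters are isomorphic to the pieces -/

/-- kernel (gen 43's leg embedding IS the leg map of its block embedding): `legEmb P l k = legOf (blockEmb P l k) _`.
[cite: Balaban1983Higgs3, (1.21) p.416] -/
theorem legEmb_eq_legOf (P : TwoLegGraph nbar) (l : List (TwoLegGraph nbar)) (k : ℕ) (x : Leg (letter P l k).G.kind) :
    legEmb P l k x = legOf (blockEmb P l k) (kind_blockEmb P l k) x := by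
  induction l generalizing P k with
  | nil =>
      obtain ⟨v, s⟩ := x
      cases k <;> refine leg_ext rfl ?_ <;> cases s <;> rfl
  | cons P' l ih =>
      obtain ⟨v, s⟩ := x
      cases k with
      | zero =>
          refine leg_ext rfl ?_
          cases s <;> rfl
      | succ k =>
          rw [legEmb_cons_succ, ih P' k]
          refine leg_ext rfl ?_
          cases s <;> rfl

/-- A TRANSCRIPTION of the pieces of `T` into the letters of a chain («(ours)», the datum of §3): a head letter, a list of
`m` further letters, and for every `k ≤ m` an isomorphism of two-leg insertions from the `k`-th piece of `T` onto the `k`-th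
letter.  §4 supplies the tautological one (letters := the pieces). [cite: Balaban1983Higgs3, (1.21) p.416] -/
structure Letters (T : TwoLegGraph nbar) (hU : Unglueable T) where
  /-- the head letter -/
  head : TwoLegGraph nbar
  /-- the further letters -/
  tail : List (TwoLegGraph nbar)
  /-- there are `m + 1` letters -/
  length_eq : tail.length = Ns T
  /-- the `k`-th piece is isomorphic to the `k`-th letter -/
  iso : ∀ (k : ℕ) (hk : k ≤ Ns T), TwoLegGraphIso (piece T hU k hk) (letter head tail k)

section Unglue

variable {T : TwoLegGraph nbar} {hU : Unglueable T} (D : Letters T hU)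

/-- THE VERTEX MAP of the ungluing: a vertex of `T` of level `k` goes, through its index in the `k`-th piece and the `k`-th
isomorphism, to the `k`-th block of the chain. [cite: Balaban1983Higgs3, (1.21) p.416] -/
noncomputable def unglueVert (v : Fin T.G.nV) : Fin (chain D.head D.tail).G.nV :=
  blockEmb D.head D.tail (Lv T v)
    ((D.iso (Lv T v) (level_le v)).toEquiv (pieceIdx v rfl))

/-- kernel: the vertex map on a vertex of known level `k`. [cite: Balaban1983Higgs3, (1.21) p.416] -/
theorem unglueVert_eq {v : Fin T.G.nV} {k : ℕ} (h : Lv T v = k)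
    (hk : k ≤ Ns T) :
    unglueVert D v = blockEmb D.head D.tail k ((D.iso k hk).toEquiv (pieceIdx v h)) := by
  subst h
  rfl

/-- kernel: the vertex map lands in the block of the level. [cite: Balaban1983Higgs3, (1.21) p.416] -/
theorem blockOf_unglueVert (v : Fin T.G.nV) :
    blockOf D.head D.tail (unglueVert D v) = Lv T v := by
  rw [unglueVert, blockOf_blockEmb_of_le _ _ (by rw [D.length_eq]; exact level_le v)]

/-- **the vertex map is injective**. [cite: Balaban1983Higgs3, (1.21) p.416] -/
theorem unglueVert_injective : Function.Injective (unglueVert D) := by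
  intro v w h
  have hl : Lv T v = Lv T w := by
    rw [← blockOf_unglueVert D v, h, blockOf_unglueVert]
  rw [unglueVert_eq D rfl (level_le v), unglueVert_eq D hl.symm (level_le v)] at h
  have h2 := (D.iso _ (level_le v)).toEquiv.injective (blockEmb_injective _ _ _ h)
  have h3 := congrArg (pieceEmb T (Lv T v)) h2
  rwa [pieceEmb_pieceIdx, pieceEmb_pieceIdx] at h3

/-- **the vertex map is surjective**. [cite: Balaban1983Higgs3, (1.21) p.416] -/
theorem unglueVert_surjective : Function.Surjective (unglueVert D) := by
  intro w
  obtain ⟨k, hk, u, rfl⟩ := exists_blockEmb_eq D.head D.tail w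
  have hk' : k ≤ Ns T := by rw [← D.length_eq]; exact hk
  set u' : Fin (pieceCard T k) := (D.iso k hk').toEquiv.symm u with hu'
  refine ⟨pieceEmb T k u', ?_⟩
  rw [unglueVert_eq D (lvl_pieceEmb k u') hk', pieceIdx_pieceEmb, hu', Equiv.apply_symm_apply]

/-- THE VERTEX BIJECTION of the ungluing. [cite: Balaban1983Higgs3, (1.21) p.416] -/
noncomputable def unglueEquiv : Fin T.G.nV ≃ Fin (chain D.head D.tail).G.nV :=
  Equiv.ofBijective (unglueVert D) ⟨unglueVert_injective D, unglueVert_surjective D⟩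

/-- **the vertex map keeps the catalogue kinds**. [cite: Balaban1983Higgs3, (1.21) p.416] -/
theorem kind_unglueVert (v : Fin T.G.nV) : (chain D.head D.tail).G.kind (unglueVert D v) = T.G.kind v := by
  rw [unglueVert_eq D rfl (level_le v), kind_blockEmb, (D.iso _ (level_le v)).kind_eq]
  change T.G.kind (pieceEmb T _ (pieceIdx v rfl)) = T.G.kind v
  rw [pieceEmb_pieceIdx]

/-- **THE LEG MAP of the ungluing, computed**: a leg at a vertex of level `k` goes to the embedded image (gen 43's `legEmb`)
of its lift to the `k`-th piece carried through the `k`-th isomorphism. [cite: Balaban1983Higgs3, (1.21) p.416] -/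
theorem legOf_unglueVert_eq (x : Leg T.G.kind) {k : ℕ} (h : Lv T x.1 = k)
    (hk : k ≤ Ns T) :
    legOf (unglueEquiv D) (kind_unglueVert D) x =
      legEmb D.head D.tail k ((D.iso k hk).toGraphIso.legMap (liftLeg T k x h)) := by
  subst h
  rw [legEmb_eq_legOf]
  obtain ⟨v, s⟩ := x
  refine leg_ext (unglueVert_eq D rfl hk) ?_
  cases s <;> rfl

/-- kernel: the lift of the in-port is the in-leg of the piece. [cite: Balaban1983Higgs3, (1.21) p.416] -/
theorem liftLeg_portIn (k : ℕ) (hk : k ≤ Ns T)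
    (h : Lv T (portIn T k).1 = k) : liftLeg T k (portIn T k) h = (piece T hU k hk).legIn := rfl

/-- kernel: the lift of the out-port is the out-leg of the piece. [cite: Balaban1983Higgs3, (1.21) p.416] -/
theorem liftLeg_portOut (k : ℕ) (hk : k ≤ Ns T)
    (h : Lv T (portOut T k).1 = k) : liftLeg T k (portOut T k) h = (piece T hU k hk).legOut := rfl

/-- kernel: the line of the piece through a lifted leg, read off `T`. [cite: Balaban1983Higgs3, (1.21) p.416] -/
theorem piece_other_liftLeg_eq_none {k : ℕ} (hk : k ≤ Ns T) {x : Leg T.G.kind}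
    (h : Lv T x.1 = k) (hx : ∀ z, T.G.other x = some z → Lv T z.1 ≠ k) :
    (piece T hU k hk).G.other (liftLeg T k x h) = none :=
  pieceOther_eq_none_iff.2 (by rw [pieceLeg_liftLeg]; exact hx)

/-- **THE LINES ARE CARRIED ALONG** — the heart of the ungluing: an external leg of `T` goes to an external leg of the chain,
a line of `T` inside the piece `V_k` goes to the embedded line of the `k`-th letter, and the `k`-th separating line of `T` goes
to the `k`-th glue line of the chain (gen 43's `other_legEmb_eq_none_iff`, `other_legEmb`, `other_legEmb_legOut` read
backwards). [cite: Balaban1983Higgs3, (1.21) p.416] -/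
theorem other_legOf_unglueVert (x : Leg T.G.kind) :
    (chain D.head D.tail).G.other (legOf (unglueEquiv D) (kind_unglueVert D) x) =
      (T.G.other x).map (legOf (unglueEquiv D) (kind_unglueVert D)) := by
  have hT := hU.conn
  obtain ⟨k, hkx⟩ : ∃ k, Lv T x.1 = k := ⟨_, rfl⟩
  have hk : k ≤ Ns T := hkx ▸ level_le x.1
  have hkl : k ≤ D.tail.length := by rw [D.length_eq]; exact hk
  rw [legOf_unglueVert_eq D x hkx hk]
  -- the lifted leg is a port of the piece only if the corresponding line of `T` leaves the level
  have portIn_case : liftLeg T k x hkx = (piece T hU k hk).legIn → x = portIn T k := fun e =>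
    liftLeg_inj (e.trans (liftLeg_portIn k hk (lvl_portIn hT hk)).symm)
  have portOut_case : liftLeg T k x hkx = (piece T hU k hk).legOut → x = portOut T k := fun e =>
    liftLeg_inj (e.trans (liftLeg_portOut k hk (lvl_portOut hT hk)).symm)
  cases hxy : T.G.other x with
  | none =>
      -- an external leg of `T`
      rw [Option.map_none, other_legEmb_eq_none_iff _ _ hkl]
      refine ⟨((D.iso k hk).toGraphIso.other_legMap_eq_none_iff).2
          (piece_other_liftLeg_eq_none hk hkx (fun z hz => by rw [hxy] at hz; cases hz)), fun e => ?_, fun e => ?_⟩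
      · have hx : x = portIn T k :=
          portIn_case ((D.iso k hk).toGraphIso.legMap_injective (e.trans (D.iso k hk).legMap_legIn.symm))
        by_contra hk0
        obtain ⟨k', rfl⟩ := Nat.exists_eq_add_one_of_ne_zero hk0
        have := other_portIn_succ hT (k := k') (by omega)
        rw [← hx, hxy] at this
        cases this
      · have hx : x = portOut T k :=
          portOut_case ((D.iso k hk).toGraphIso.legMap_injective (e.trans (D.iso k hk).legMap_legOut.symm))
        rw [D.length_eq]
        by_contra hkm
        have := other_portOut_of_lt hT (lt_of_le_of_ne hk hkm)
        rw [← hx, hxy] at this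
        cases this
  | some y =>
      rw [Option.map_some]
      by_cases hyk : Lv T y.1 = k
      · -- a line inside the piece `V_k`
        have hin : (piece T hU k hk).G.other (liftLeg T k x hkx) = some (liftLeg T k y hyk) :=
          pieceOther_liftLeg hxy hkx hyk
        have h₁ : liftLeg T k x hkx ≠ (piece T hU k hk).legIn := fun e => by
          have := (piece T hU k hk).in_ext
          rw [← e, hin] at this
          cases this
        have h₂ : liftLeg T k x hkx ≠ (piece T hU k hk).legOut := fun e => by
          have := (piece T hU k hk).out_ext
          rw [← e, hin] at this
          cases this
        rw [other_legEmb _ _ k _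
            (fun e => absurd ((D.iso k hk).toGraphIso.legMap_injective (e.trans (D.iso k hk).legMap_legIn.symm)) h₁)
            (fun e => absurd ((D.iso k hk).toGraphIso.legMap_injective (e.trans (D.iso k hk).legMap_legOut.symm)) h₂),
          ((D.iso k hk).toGraphIso.other_legMap_eq_some_iff).2 hin, Option.map_some, legOf_unglueVert_eq D y hyk hk]
      · -- a separating line: a glue line of the chain, crossed forwards or backwards
        have hsep : Sep T.G T.legIn.1 T.legOut.1 x := by
          by_contra hns
          exact hyk ((level_eq_of_not_sep hxy hns).symm.trans hkx)
        rcases hsep.level_cases hT hxy with ⟨hnx, hly⟩ | ⟨hny, hlx⟩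
        · -- `x` is the near leg at level `k`: the out-port of piece `k`, `y` the in-port of piece `k + 1`
          have hkm : k < Ns T := hkx ▸ hnx.level_lt
          have hx : x = portOut T k := by rw [portOut_of_lt hkm]; exact eq_nearAt hT hnx hkx
          have hy : y = portIn T (k + 1) := by
            have := other_portOut_of_lt hT hkm
            rw [← hx, hxy] at this
            exact Option.some.inj this
          have ex : liftLeg T k x hkx = (piece T hU k hk).legOut :=
            (liftLeg_congr hx).trans (liftLeg_portOut k hk (lvl_portOut hT hk))
          have hyl : Lv T y.1 = k + 1 := by rw [hly, hkx]
          have ey : liftLeg T (k + 1) y hyl = (piece T hU (k + 1) hkm).legIn :=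
            (liftLeg_congr hy).trans (liftLeg_portIn (k + 1) hkm (lvl_portIn hT hkm))
          rw [ex, (D.iso k hk).legMap_legOut, other_legEmb_legOut _ _ (by rw [D.length_eq]; exact hkm),
            legOf_unglueVert_eq D y hyl hkm, ey, (D.iso (k + 1) hkm).legMap_legIn]
        · -- `y` is the near leg at level `k - 1`: `x` is the in-port of piece `k`, `y` the out-port of piece `k - 1`
          obtain ⟨j, hjy⟩ : ∃ j, Lv T y.1 = j := ⟨_, rfl⟩
          have hjk : j + 1 = k := by rw [← hjy, ← hkx]; exact hlx.symm
          subst hjk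
          have hjm : j < Ns T := hjy ▸ hny.level_lt
          have hy : y = portOut T j := by rw [portOut_of_lt hjm]; exact eq_nearAt hT hny hjy
          have hx : x = portIn T (j + 1) := by
            have := other_portOut_of_lt hT hjm
            rw [← hy, T.G.other_symm _ _ hxy] at this
            exact Option.some.inj this
          have ex : liftLeg T (j + 1) x hkx = (piece T hU (j + 1) hk).legIn :=
            (liftLeg_congr hx).trans (liftLeg_portIn (j + 1) hk (lvl_portIn hT hk))
          have hj : j ≤ Ns T := hjm.le
          have ey : liftLeg T j y hjy = (piece T hU j hj).legOut :=
            (liftLeg_congr hy).trans (liftLeg_portOut j hj (lvl_portOut hT hj))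
          rw [ex, (D.iso (j + 1) hk).legMap_legIn, other_legEmb_succ_legIn _ _ (by rw [D.length_eq]; exact hjm),
            legOf_unglueVert_eq D y hjy hj, ey, (D.iso j hj).legMap_legOut]

/-- **THE UNGLUING ISOMORPHISM**: a connected two-leg insertion whose separating lines are φ′-lines and whose pieces span
lines is isomorphic, as a two-leg insertion, to the chain of any letters isomorphic to its pieces — «glue ∘ decompose ≅ id».
[cite: Balaban1983Higgs3, (1.21) p.416] -/
noncomputable def unglueIso : TwoLegGraphIso T (chain D.head D.tail) where
  toEquiv := unglueEquiv D
  kind_eq := kind_unglueVert D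
  map_other := other_legOf_unglueVert D
  map_legIn := by
    have h0 : 0 ≤ Ns T := Nat.zero_le _
    have e : liftLeg T 0 T.legIn level_left = (piece T hU 0 h0).legIn :=
      (liftLeg_congr portIn_zero.symm).trans (liftLeg_portIn 0 h0 (lvl_portIn hU.conn h0))
    rw [legOf_unglueVert_eq D T.legIn level_left h0, e, (D.iso 0 h0).legMap_legIn]
    exact legEmb_zero_legIn D.head D.tail
  map_legOut := by
    have hm : Ns T ≤ Ns T := le_rfl
    have e : liftLeg T _ T.legOut level_right = (piece T hU _ hm).legOut :=
      (liftLeg_congr portOut_nsep.symm).trans (liftLeg_portOut _ hm (lvl_portOut hU.conn hm))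
    rw [legOf_unglueVert_eq D T.legOut level_right hm, e, (D.iso _ hm).legMap_legOut]
    have key : ∀ k, k = D.tail.length →
        legEmb D.head D.tail k (letter D.head D.tail k).legOut = (chain D.head D.tail).legOut := by
      rintro k rfl
      exact legEmb_length_legOut D.head D.tail
    exact key _ D.length_eq.symm

end Unglue

/-! ## §4 The canonical transcription: `T` is the chain of its own pieces -/

/-- Transport of structure along an equality of two-leg insertions (plumbing). [cite: Balaban1983Higgs3, (1.21) p.416] -/
noncomputable def isoOfEq {A B : TwoLegGraph nbar} (e : A = B) : TwoLegGraphIso A B := by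
  subst e
  exact TwoLegGraphIso.refl A

section Canonical

variable (T : TwoLegGraph nbar)

section WithHyp

variable (hU : Unglueable T)

/-- THE HEAD LETTER: the piece `V_0` (the one carrying the in-leg of `T`). [cite: Balaban1983Higgs3, (1.21) p.416] -/
noncomputable def headPiece : TwoLegGraph nbar :=
  piece T hU 0 (Nat.zero_le _)

/-- THE FURTHER LETTERS: the pieces `V_1, …, V_m` in the order of the chain. [cite: Balaban1983Higgs3, (1.21) p.416] -/
noncomputable def tailPieces : List (TwoLegGraph nbar) :=
  List.ofFn fun k : Fin (Ns T) => piece T hU (k + 1) k.2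

/-- kernel: there are `m` further letters. [cite: Balaban1983Higgs3, (1.21) p.416] -/
@[simp] theorem length_tailPieces : (tailPieces T hU).length = Ns T := by
  simp [tailPieces]

/-- kernel: the `k`-th letter of the chain of pieces is the `k`-th piece. [cite: Balaban1983Higgs3, (1.21) p.416] -/
theorem letter_pieces (k : ℕ) (hk : k ≤ Ns T) :
    letter (headPiece T hU) (tailPieces T hU) k = piece T hU k hk := by
  cases k with
  | zero => rfl
  | succ k =>
      rw [letter_eq_getElem _ _ (k + 1) (by simp; omega)]
      simp [tailPieces]

/-- The canonical transcription: letters := the pieces themselves. [cite: Balaban1983Higgs3, (1.21) p.416] -/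
noncomputable def pieceLetters : Letters T hU where
  head := headPiece T hU
  tail := tailPieces T hU
  length_eq := length_tailPieces T hU
  iso k hk := isoOfEq (letter_pieces T hU k hk).symm

/-- **«A CONNECTED TWO-POINT GRAPH IS THE CHAIN OF ITS PROPER PIECES JOINED BY SINGLE PROPAGATOR LINES» — the converse of
p37's synthesis `B3OnePIChainGlue.chain`, up to isomorphism**: a two-leg insertion `T` of p18's model that is connected, whose
separating lines are φ′-lines and whose pieces span lines, is ISOMORPHIC to the chain `chain V_0 [V_1, …, V_m]` of its own
pieces — the graph of the term `C₀^ε V_0 C₀^ε V_1 ⋯ V_m C₀^ε` of (1.21).  With gen 43's `B3OnePIChainBlocks` («decompose ∘ glue =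
id») the two operations are mutually inverse. [cite: Balaban1983Higgs3, (1.21) p.416] -/
noncomputable def isoChainPieces : TwoLegGraphIso T (chain (headPiece T hU) (tailPieces T hU)) :=
  unglueIso (pieceLetters T hU)

/-- **the letters of that chain are connected insertions, proper between their ports** (so by p37's `not_isProper_chain` none
of them is itself a chain of ≥ 2 pieces: the decomposition is into irreducible letters).
[cite: Balaban1983Higgs3, (1.21) p.416] -/
theorem letter_pieces_connected_proper (k : ℕ) (hk : k ≤ Ns T) :
    IsConnected (letter (headPiece T hU) (tailPieces T hU) k).G ∧
      numSep (letter (headPiece T hU) (tailPieces T hU) k).G (letter (headPiece T hU) (tailPieces T hU) k).legIn.1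
        (letter (headPiece T hU) (tailPieces T hU) k).legOut.1 = 0 := by
  rw [letter_pieces T hU k hk]
  exact ⟨isConnected_piece hU k hk, numSep_piece hU k hk⟩

end WithHyp

/-- **THE UNGLUING THEOREM (existential form)**: under (conn) ∧ (a) ∧ (b) there are `m + 1` connected, port-proper two-leg
insertions `P, l₁, …, l_m` (`m = numSep`) with `T ≅ chain P [l₁, …, l_m]`. [cite: Balaban1983Higgs3, (1.21) p.416] -/
theorem exists_iso_chain (hU : Unglueable T) :
    ∃ (P : TwoLegGraph nbar) (l : List (TwoLegGraph nbar)),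
      l.length = Ns T ∧
      (∀ k ≤ l.length, IsConnected (letter P l k).G ∧
        numSep (letter P l k).G (letter P l k).legIn.1 (letter P l k).legOut.1 = 0) ∧
      Nonempty (TwoLegGraphIso T (chain P l)) :=
  ⟨headPiece T hU, tailPieces T hU, length_tailPieces T hU,
    fun k hk => letter_pieces_connected_proper T hU k (by simpa using hk), ⟨isoChainPieces T hU⟩⟩

end Canonical

/-! ## §5 The image of the chain construction: letters, and the characterization -/

section Letters

/-- A LETTER of (1.21) on the model («(ours)»): a two-leg insertion that is CONNECTED and PROPER BETWEEN ITS PORTS — no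
internal line separates its in-leg from its out-leg (`numSep = 0`; the channel form of irreducibility; p37's `IsProper` and
`IsOnePI` insertions are letters, `isLetter_of_isProper`). [cite: Balaban1983Higgs3, (1.21) p.416] -/
def IsLetter (X : TwoLegGraph nbar) : Prop :=
  IsConnected X.G ∧ Ns X = 0

/-- kernel: a proper insertion (p37's `IsProper`: no line separates ANY two external legs) is a letter; in particular every
1PI insertion is (`IsOnePI.isProper`). [cite: Balaban1983Higgs3, (1.21) p.416] -/
theorem isLetter_of_isProper {X : TwoLegGraph nbar} (h : IsProper X.G) : IsLetter X :=
  ⟨h.isConnected, (isProper_iff_numSep_eq_zero h.isConnected).1 h X.legIn X.legOut X.in_ext X.out_ext⟩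

/-- kernel: being a letter is invariant under isomorphism. [cite: Balaban1983Higgs3, (1.21) p.416] -/
theorem isLetter_iff_of_iso {X Y : TwoLegGraph nbar} (e : TwoLegGraphIso X Y) : IsLetter Y ↔ IsLetter X := by
  rw [IsLetter, IsLetter, e.isConnected_iff, e.numSep_eq]

/-- **the pieces of an unglueable insertion are letters**. [cite: Balaban1983Higgs3, (1.21) p.416] -/
theorem isLetter_piece {T : TwoLegGraph nbar} (hU : Unglueable T) (k : ℕ) (hk : k ≤ Ns T) : IsLetter (piece T hU k hk) :=
  ⟨isConnected_piece hU k hk, numSep_piece hU k hk⟩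

/-- kernel: the letters of the chain of pieces are letters. [cite: Balaban1983Higgs3, (1.21) p.416] -/
theorem isLetter_letter_pieces (T : TwoLegGraph nbar) (hU : Unglueable T) (k : ℕ) (hk : k ≤ (tailPieces T hU).length) :
    IsLetter (letter (headPiece T hU) (tailPieces T hU) k) :=
  letter_pieces_connected_proper T hU k (by simpa using hk)

variable {P : TwoLegGraph nbar} {l : List (TwoLegGraph nbar)}

/-- kernel: a property of all letters `letter P l k`, `k ≤ l.length`, is a property of the head and of every list entry.
[cite: Balaban1983Higgs3, (1.21) p.416] -/
theorem forall_mem_of_forall_letter {Q : TwoLegGraph nbar → Prop} (h : ∀ k ≤ l.length, Q (letter P l k)) :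
    Q P ∧ ∀ T' ∈ l, Q T' := by
  refine ⟨by simpa using h 0 (Nat.zero_le _), fun T' hT' => ?_⟩
  obtain ⟨i, hi, rfl⟩ := List.getElem_of_mem hT'
  have := h (i + 1) (by omega)
  rwa [letter_eq_getElem _ _ (i + 1) (by simpa using hi), List.getElem_cons_succ] at this

/-- **a chain of `r + 1` letters has exactly `r` separating lines** (gen 42's `numSep_chain` with all letter terms `0`).
[cite: Balaban1983Higgs3, (1.21) p.416] -/
theorem numSep_chain_of_letters (h : ∀ k ≤ l.length, IsLetter (letter P l k)) : Ns (chain P l) = l.length := by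
  obtain ⟨hP, hl⟩ := forall_mem_of_forall_letter (Q := IsLetter) h
  rw [numSep_chain P l hP.1 (fun T' hT' => (hl T' hT').1), hP.2]
  have hsum : (l.map fun T' => Ns T').sum = 0 :=
    List.sum_eq_zero (fun m hm => by
      obtain ⟨T', hT', rfl⟩ := List.mem_map.1 hm
      exact (hl T' hT').2)
  rw [hsum]
  simp

/-- **in a chain of letters the level is the block index** (gen 43's `level_chain_blockEmb` with all letter terms `0`).
[cite: Balaban1983Higgs3, (1.21) p.416] -/
theorem level_chain_blockEmb_of_letters (h : ∀ k ≤ l.length, IsLetter (letter P l k)) {k : ℕ} (hk : k ≤ l.length)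
    (v : Fin (letter P l k).G.nV) : Lv (chain P l) (blockEmb P l k v) = k := by
  obtain ⟨hP, hl⟩ := forall_mem_of_forall_letter (Q := IsLetter) h
  rw [level_chain_blockEmb hP.1 (fun T' hT' => (hl T' hT').1) hk v, sum_eq_zero (fun j hj => (h j ?_).2), zero_add]
  · have := level_le (G := (letter P l k).G) (i := (letter P l k).legIn.1) (j := (letter P l k).legOut.1) v
    rw [(h k hk).2] at this
    omega
  · exact (mem_range.1 hj).le.trans hk

/-- **A CHAIN OF LETTERS IS UNGLUEABLE**: it is connected, its separating lines are exactly the glue lines (gen 43's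
`mem_nearLegs_chain_iff`), which are φ′-lines, and its `k`-th piece contains the `k`-th block, which spans a line of the
`k`-th letter (p. 415 "at least one internal line"). [cite: Balaban1983Higgs3, (1.21) p.416] -/
theorem unglueable_chain (h : ∀ k ≤ l.length, IsLetter (letter P l k)) : Unglueable (chain P l) := by
  obtain ⟨hP, hl⟩ := forall_mem_of_forall_letter (Q := IsLetter) h
  have hconn : IsConnected (chain P l).G := isConnected_chain hP.1 (fun T' hT' => (hl T' hT').1)
  -- the near legs of the chain are the embedded out-legs of the letters `k < l.length`
  have near : ∀ d, IsNear (chain P l).G (chain P l).legIn.1 (chain P l).legOut.1 d →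
      ∃ k, k < l.length ∧ d = legEmb P l k (letter P l k).legOut := by
    intro d hd
    rcases (mem_nearLegs_chain_iff hP.1 (fun T' hT' => (hl T' hT').1) d).1 (mem_nearLegs.2 hd) with
      h1 | ⟨k, hk, x, hx, -⟩
    · exact h1
    · have h0 : nearLegs (letter P l k).G (letter P l k).legIn.1 (letter P l k).legOut.1 = ∅ := by
        have := (h k hk).2
        rwa [numSep, card_eq_zero] at this
      rw [h0] at hx
      simp at hx
  refine ⟨hconn, fun c hc => ?_, fun k hk => ?_⟩
  · -- (a) separating lines of the chain are glue lines, joining scalar ports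
    obtain ⟨c', hc'⟩ := hc.exists_other
    rcases hc.isNear_or hconn hc' with hn | hn
    · obtain ⟨k, hk, rfl⟩ := near c hn
      rw [isLeft_legEmb]
      exact (letter P l k).out_scalar
    · obtain ⟨k, hk, rfl⟩ := near c' hn
      have e : c = legEmb P l (k + 1) (letter P l (k + 1)).legIn := by
        have := (chain P l).G.other_symm _ _ hc'
        rw [other_legEmb_legOut P l hk] at this
        exact (Option.some.inj this).symm
      rw [e, isLeft_legEmb]
      exact (letter P l (k + 1)).in_scalar
  · -- (b) the `k`-th letter has a line, embedded inside the `k`-th piece of the chain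
    rw [numSep_chain_of_letters h] at hk
    obtain ⟨x₀, hx₀⟩ := (letter P l k).G.exists_line
    obtain ⟨y₀, hy₀⟩ := Option.isSome_iff_exists.1 hx₀
    have h₁ : x₀ = (letter P l k).legIn → k = 0 := fun e => by
      have := (letter P l k).in_ext
      rw [← e, hy₀] at this
      cases this
    have h₂ : x₀ = (letter P l k).legOut → l.length ≤ k := fun e => by
      have := (letter P l k).out_ext
      rw [← e, hy₀] at this
      cases this
    refine ⟨legEmb P l k x₀, legEmb P l k y₀, by rw [other_legEmb P l k x₀ h₁ h₂, hy₀, Option.map_some], ?_, ?_⟩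
    · rw [fst_legEmb]; exact level_chain_blockEmb_of_letters h hk _
    · rw [fst_legEmb]; exact level_chain_blockEmb_of_letters h hk _

/-- **`Unglueable` is invariant under isomorphism of two-leg insertions**. [cite: Balaban1983Higgs3, (1.21) p.416] -/
theorem unglueable_of_iso {T T' : TwoLegGraph nbar} (e : TwoLegGraphIso T T') (h : Unglueable T) : Unglueable T' := by
  refine ⟨e.isConnected_iff.2 h.conn, fun c' hc' => ?_, fun k hk => ?_⟩
  · obtain ⟨c, rfl⟩ := e.toGraphIso.legMap_surjective c'
    have key := e.toGraphIso.sep_iff (i := T.legIn.1) (j := T.legOut.1) (c := c)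
    rw [e.toEquiv_legIn_fst, e.toEquiv_legOut_fst] at key
    rw [GraphIso.isLeft_legMap]
    exact h.sepScalar c (key.1 hc')
  · rw [e.numSep_eq] at hk
    obtain ⟨x, y, hxy, hx, hy⟩ := h.spans k hk
    refine ⟨e.toGraphIso.legMap x, e.toGraphIso.legMap y, e.toGraphIso.other_legMap_eq_some_iff.2 hxy, ?_, ?_⟩
    · rw [GraphIso.fst_legMap, e.level_eq]; exact hx
    · rw [GraphIso.fst_legMap, e.level_eq]; exact hy

/-- kernel: … in both directions. [cite: Balaban1983Higgs3, (1.21) p.416] -/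
theorem unglueable_iff_of_iso {T T' : TwoLegGraph nbar} (e : TwoLegGraphIso T T') : Unglueable T' ↔ Unglueable T :=
  ⟨unglueable_of_iso e.symm, unglueable_of_iso e⟩

/-- **THE CHARACTERIZATION OF THE CHAINS OF (1.21) ON p18's MODEL**: a two-leg insertion is isomorphic to a chain
`chain P [l₁, …, l_r]` of LETTERS (connected insertions, proper between their ports — e.g. 1PI graphs) if and only if it is
connected, its separating lines are φ′-lines, and each of its pieces spans an internal line; and then `r = numSep` and the
letters may be taken to be its own pieces (`isoChainPieces`). «Connected two-point graph = chain of proper insertions joined by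
single propagator lines», both directions, up to isomorphism. [cite: Balaban1983Higgs3, (1.21) p.416] -/
theorem unglueable_iff_nonempty_iso_chain (T : TwoLegGraph nbar) :
    Unglueable T ↔ ∃ (P : TwoLegGraph nbar) (l : List (TwoLegGraph nbar)),
      (∀ k ≤ l.length, IsLetter (letter P l k)) ∧ Nonempty (TwoLegGraphIso T (chain P l)) := by
  constructor
  · intro hU
    exact ⟨headPiece T hU, tailPieces T hU, fun k hk => isLetter_letter_pieces T hU k hk, ⟨isoChainPieces T hU⟩⟩
  · rintro ⟨P, l, hl, ⟨e⟩⟩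
    exact unglueable_of_iso e.symm (unglueable_chain hl)

/-- **the number of letters is determined**: if `T ≅ chain P [l₁, …, l_r]` with letters, then `r = numSep T`.
[cite: Balaban1983Higgs3, (1.21) p.416] -/
theorem length_eq_numSep_of_iso {T : TwoLegGraph nbar} (hl : ∀ k ≤ l.length, IsLetter (letter P l k))
    (e : TwoLegGraphIso T (chain P l)) : l.length = Ns T := by
  rw [← numSep_chain_of_letters hl, e.numSep_eq]

end Letters

end Literature.MathematicalPhysics.QuantumFieldTheory.Balaban1983to89.B3OnePIChainUnglue
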